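import Mathlib
import HarnessLib
import Summits.ABC.ABC.Theses.CongruentialReceptacle
import Summits.ABC.ABC.Theorems.CongruentialReceptacleCompactBalanceTransferPowerDeep

/-!
# Crux `CompactBalanceTransfer` (stmt-ABC-1725), line `birth` — the exact reach of `F` on every power cell

Support file (`--supports stmt-ABC-1725`) of the line lead `prover-line-stmt-ABC-1725-c7-0` (2026-08-17) for the
registered skeleton `Cruxes/CompactBalanceTransfer/Lines/birth.lean`, stub `stub_freySzpiroPowerDeep : F → ∀ δ > 0,
abc(1+ε) on {log min(a,b) ≤ (1−δ)·log c}` (≡ Oesterlé's `F → ABC`, `PowerDeep.freySzpiroToABC_iff_powerDeep`).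

`abcExponent_of_freySzpiro_on_powerCell`: the Frey–Szpiro hypothesis
`F := ∀ ε > 0, ∃ C, ∀ abc-triples, (abc)² ≤ C·rad(abc)^(6+ε)` gives, on the power cell `{min(a,b) ≥ c^θ}`
(`θ·log c ≤ log min(a,b)`, any real `θ ≥ 0`), abc with exponent `6/(4+2θ) + ε` — and nothing better is extracted by
this argument. This is the formula quoted informally in the crux's docstring ("Szpiro on θ-balanced Frey curves only
yields abc-exponent (6+ε)/(4+2θ)") and in `Cruxes/CompactBalanceTransfer/STRATEGY-CENSUS.md` §4 D5, now kernel-checked.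
It interpolates the two landed endpoints: `θ = 0` is `PowerDeep.abc_threeHalves_of_freySzpiro` (exponent `3/2`, all
triples) and `θ → 1` is the compactly balanced cell (exponent `→ 1`, the content of `freySzpiroAll_balanced` /
the route's Assembly). Read on the boundary `θ = 1 − δ` of stub 2's cell it says exactly how far `F` falls short there:
exponent `6/(6−2δ) = 1 + δ/(3−δ) > 1`, for every `δ ∈ (0,1]` — the residual of the stub is the whole cell, quantitatively.

Proof: `abc = min·max·c ≥ c^θ · (c/2) · c`, so `F` at `ε' := (4+2θ)ε` gives
`(4+2θ)·log c ≤ log C + 2 log 2 + (6+ε')·log rad`, and `(6+ε')/(4+2θ) = 6/(4+2θ) + ε`.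
Unconditional; hypotheses spelled out (no `def`s); standard axioms; no named facts.
-/

-- `Summit.<Summit>.<Problem>`: for the single-conjunct summit `ABC` the duplicate `ABC.ABC` is mandated.
set_option linter.dupNamespace false

namespace Summit.ABC.ABC.Theorems.CompactBalanceTransfer.PowerCellReach

open Literature.NumberTheory.DiophantineGeometry
open Summit.ABC.ABC.Theses.CongruentialReceptacle
open Summit.ABC.ABC.Theorems.CompactBalanceTransfer.PowerDeep

/-- For an abc triple, `c ≤ 2·max(a,b)`. [folklore] -/
theorem le_two_mul_max_of_isABCTriple {a b c : ℕ} (h : IsABCTriple a b c) : c ≤ 2 * max a b := by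
  obtain ⟨_, _, hsum, _⟩ := h
  subst hsum
  rcases le_total a b with hab | hab
  · rw [max_eq_right hab]; omega
  · rw [max_eq_left hab]; omega

/-- **The reach of `F` on the power cell `{min(a,b) ≥ c^θ}`: abc with exponent `6/(4+2θ) + ε`.**
If `(abc)² ≤ C_η·rad(abc)^(6+η)` for every `η > 0` (Szpiro `6+ε` for the Frey curves of all abc-triples, elementary
currency), then for every real `θ ≥ 0` and `ε > 0` there is `C > 0` with `c < C·rad(abc)^(6/(4+2θ)+ε)` for every
abc-triple satisfying `θ·log c ≤ log min(a,b)`. At `θ = 0` this is Oesterlé's exponent `3/2`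
(`PowerDeep.abc_threeHalves_of_freySzpiro`); at `θ = 1 − δ` it is exponent `6/(6−2δ) > 1`, the quantitative form of
"`F` alone does not prove stub 2 of line `birth` on any power-deep cell" (census D5). [folklore] -/
theorem abcExponent_of_freySzpiro_on_powerCell :
    (∀ ε : ℝ, 0 < ε → ∃ C : ℝ, ∀ a b c : ℕ, IsABCTriple a b c →
      ((a * b * c : ℕ) : ℝ) ^ 2 ≤ C * ((rad a b c : ℕ) : ℝ) ^ (6 + ε)) →
    ∀ θ : ℝ, 0 ≤ θ → ∀ ε : ℝ, 0 < ε → ∃ C : ℝ, 0 < C ∧ ∀ a b c : ℕ, IsABCTriple a b c →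
      θ * Real.log (c : ℝ) ≤ Real.log ((min a b : ℕ) : ℝ) →
        (c : ℝ) < C * ((rad a b c : ℕ) : ℝ) ^ (6 / (4 + 2 * θ) + ε) := by
  intro hF θ hθ ε hε
  have hDpos : (0 : ℝ) < 4 + 2 * θ := by linarith
  obtain ⟨CF, hCF⟩ := hF ((4 + 2 * θ) * ε) (by positivity)
  set CF' : ℝ := max CF 1 with hCF'def
  have hCF'1 : (1 : ℝ) ≤ CF' := le_max_right _ _
  have hCF'pos : (0 : ℝ) < CF' := lt_of_lt_of_le one_pos hCF'1
  set K : ℝ := (Real.log CF' + 2 * Real.log 2) / (4 + 2 * θ) + 1 with hKdef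
  refine ⟨Real.exp K, Real.exp_pos K, fun a b c habc hcell => ?_⟩
  have hF0 := hCF a b c habc
  have hmax2 := le_two_mul_max_of_isABCTriple habc
  obtain ⟨ha0, hb0, hsum, _⟩ := habc
  have hcpos : (0 : ℝ) < c := by exact_mod_cast (show 0 < c by omega)
  have hapos : (0 : ℝ) < a := by exact_mod_cast ha0
  have hbpos : (0 : ℝ) < b := by exact_mod_cast hb0
  have hminpos : (0 : ℝ) < ((min a b : ℕ) : ℝ) := by exact_mod_cast lt_min ha0 hb0
  have hmaxpos : (0 : ℝ) < ((max a b : ℕ) : ℝ) := by exact_mod_cast lt_max_of_lt_left ha0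
  have hRpos : (0 : ℝ) < ((rad a b c : ℕ) : ℝ) := by exact_mod_cast rad_pos_nat a b c
  have hR1 : (1 : ℝ) ≤ ((rad a b c : ℕ) : ℝ) := by exact_mod_cast rad_pos_nat a b c
  have hlogR : 0 ≤ Real.log ((rad a b c : ℕ) : ℝ) := Real.log_nonneg hR1
  have habcpos : (0 : ℝ) < ((a * b * c : ℕ) : ℝ) := by push_cast; positivity
  -- F in logarithms
  have hXnn : (0 : ℝ) ≤ ((rad a b c : ℕ) : ℝ) ^ (6 + (4 + 2 * θ) * ε) := Real.rpow_nonneg hRpos.le _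
  have hXpos : (0 : ℝ) < ((rad a b c : ℕ) : ℝ) ^ (6 + (4 + 2 * θ) * ε) := Real.rpow_pos_of_pos hRpos _
  have hF1 : ((a * b * c : ℕ) : ℝ) ^ 2 ≤ CF' * ((rad a b c : ℕ) : ℝ) ^ (6 + (4 + 2 * θ) * ε) :=
    le_trans hF0 (mul_le_mul_of_nonneg_right (le_max_left _ _) hXnn)
  have hlogF : 2 * Real.log ((a * b * c : ℕ) : ℝ) ≤
      Real.log CF' + (6 + (4 + 2 * θ) * ε) * Real.log ((rad a b c : ℕ) : ℝ) := by
    have h := Real.log_le_log (by positivity) hF1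
    have e2 : Real.log (((a * b * c : ℕ) : ℝ) ^ 2) = 2 * Real.log ((a * b * c : ℕ) : ℝ) := by
      rw [Real.log_pow]; norm_num
    rw [e2, Real.log_mul hCF'pos.ne' hXpos.ne', Real.log_rpow hRpos] at h
    linarith
  -- lower bound: log(abc) = log min + log max + log c ≥ θ log c + (log c − log 2) + log c
  have hsplit : ((a * b * c : ℕ) : ℝ) = ((min a b : ℕ) : ℝ) * ((max a b : ℕ) : ℝ) * (c : ℝ) := by
    have hnat : a * b * c = min a b * max a b * c := by rw [min_mul_max]
    exact_mod_cast hnat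
  have hlogabc : Real.log ((a * b * c : ℕ) : ℝ) =
      Real.log ((min a b : ℕ) : ℝ) + Real.log ((max a b : ℕ) : ℝ) + Real.log (c : ℝ) := by
    rw [hsplit, Real.log_mul (by positivity) hcpos.ne', Real.log_mul hminpos.ne' hmaxpos.ne']
  have hlogmax : Real.log (c : ℝ) - Real.log 2 ≤ Real.log ((max a b : ℕ) : ℝ) := by
    have hmax2' : (c : ℝ) ≤ 2 * ((max a b : ℕ) : ℝ) := by exact_mod_cast hmax2
    have h1 := Real.log_le_log hcpos hmax2'
    rw [Real.log_mul (by norm_num) hmaxpos.ne'] at h1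
    linarith
  have hlow : (2 + θ) * Real.log (c : ℝ) - Real.log 2 ≤ Real.log ((a * b * c : ℕ) : ℝ) := by
    rw [hlogabc]; nlinarith
  -- combine: (4+2θ) log c ≤ log CF' + 2 log 2 + (6+(4+2θ)ε) log rad, then divide by 4+2θ
  have hcomb : (4 + 2 * θ) * Real.log (c : ℝ) ≤
      Real.log CF' + 2 * Real.log 2 + (6 + (4 + 2 * θ) * ε) * Real.log ((rad a b c : ℕ) : ℝ) := by
    nlinarith
  have hlogc : Real.log (c : ℝ) < K + (6 / (4 + 2 * θ) + ε) * Real.log ((rad a b c : ℕ) : ℝ) := by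
    have e1 : (4 + 2 * θ) * (K + (6 / (4 + 2 * θ) + ε) * Real.log ((rad a b c : ℕ) : ℝ)) =
        Real.log CF' + 2 * Real.log 2 + (4 + 2 * θ) +
          (6 + (4 + 2 * θ) * ε) * Real.log ((rad a b c : ℕ) : ℝ) := by
      rw [hKdef]
      field_simp
    have key : (4 + 2 * θ) * Real.log (c : ℝ) <
        (4 + 2 * θ) * (K + (6 / (4 + 2 * θ) + ε) * Real.log ((rad a b c : ℕ) : ℝ)) := by
      rw [e1]; linarith
    exact lt_of_mul_lt_mul_left key hDpos.le
  calc (c : ℝ) = Real.exp (Real.log c) := (Real.exp_log hcpos).symm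
    _ < Real.exp (K + (6 / (4 + 2 * θ) + ε) * Real.log ((rad a b c : ℕ) : ℝ)) := Real.exp_lt_exp.mpr hlogc
    _ = Real.exp K * ((rad a b c : ℕ) : ℝ) ^ (6 / (4 + 2 * θ) + ε) := by
        rw [Real.exp_add, Real.rpow_def_of_pos hRpos, mul_comm (Real.log _) (6 / (4 + 2 * θ) + ε)]

/-- **Corollary on the boundary of stub 2's cell.** For `δ ∈ (0,1]`, `F` gives abc with exponent `6/(6−2δ) + ε` on
the power cell `{(1−δ)·log c ≤ log min(a,b)}` — exponent `> 1`, so `F` does not by itself settle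
`stub_freySzpiroPowerDeep` even on the shallowest triples of its cell; the landed composition
`PowerDeep.abc_of_freySzpiro_of_powerDeep` is the statement that it does pay for everything SHALLOWER
(`min > c^(1−δ)` with `δ → 0`). [folklore] -/
theorem abcExponent_of_freySzpiro_on_cellBoundary
    (hF : ∀ ε : ℝ, 0 < ε → ∃ C : ℝ, ∀ a b c : ℕ, IsABCTriple a b c →
      ((a * b * c : ℕ) : ℝ) ^ 2 ≤ C * ((rad a b c : ℕ) : ℝ) ^ (6 + ε)) :
    ∀ δ : ℝ, 0 < δ → δ ≤ 1 → ∀ ε : ℝ, 0 < ε → ∃ C : ℝ, 0 < C ∧ ∀ a b c : ℕ, IsABCTriple a b c →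
      (1 - δ) * Real.log (c : ℝ) ≤ Real.log ((min a b : ℕ) : ℝ) →
        (c : ℝ) < C * ((rad a b c : ℕ) : ℝ) ^ (6 / (6 - 2 * δ) + ε) := by
  intro δ _ hδ1 ε hε
  obtain ⟨C, hC, h⟩ := abcExponent_of_freySzpiro_on_powerCell hF (1 - δ) (by linarith) ε hε
  refine ⟨C, hC, fun a b c habc hcell => ?_⟩
  have e : (6 : ℝ) / (4 + 2 * (1 - δ)) = 6 / (6 - 2 * δ) := by ring_nf
  have := h a b c habc hcell
  rwa [e] at this

end Summit.ABC.ABC.Theorems.CompactBalanceTransfer.PowerCellReach
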